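import Mathlib

/-!
# Hodge-locus census — THE DUAL-DEGREE DEFICIENCY β(n,d,m) OF A TWO-PLANE CELL: closed form, enumerated
(def-free, computable helper of `stmt-HodgeConjecture-16267`; pub-hlocus, seat ivhs-2 = ENGINE B, gen 30; record
`pub-hlocus-ivhs-2/ENGINEB-g30.md` §3f, script `gen30/progU2/bformula.py`; companion of `HodgeLocusCensusDualDegreeBound.lean`)

For the cell of smooth hypersurfaces of degree `d` in `ℙ^{2p+1}` containing two `p`-planes meeting in an `m`-plane put `c = m + 1`,
`t = (p+1)(d-2)` and let `H c (d-1)` be the Hilbert function of a complete intersection of `c` forms of degree `d-1` in `c` variables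
(the coefficients of `(1 + T + ⋯ + T^{d-2})^c`).  THEOREM U′ of the record: the generic excess of the cell satisfies
`b_gen ≥ β := H(t-d) ∸ H(d)`, and PREDICTION U says equality.  This file makes `β` a computable function and kernel-checks the
ENUMERATION quoted in the record: in the census range `2 ≤ p ≤ 7` (fourfolds to fourteen-folds), `3 ≤ d ≤ 9`, `0 ≤ c ≤ p`, `β` is
positive in exactly twelve cells — the three cubic-fourfold cells (`β = 1`) and the census's nine positive-`b` cells with the census
values `(4,4,0) 1, (4,4,1) 2, (4,5,1) 1, (6,3,0) 1, (6,3,1) 2, (6,3,2) 2, (8,3,1) 1, (8,3,2) 2, (8,3,3) 2` — and the degree-`d` value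
`H c (d-1) d = C(c-1+d, d) - c^2` (the count behind the census codimension `c_N`) on the same range.

certified instances and evidence bearing on the general Hodge conjecture; no claim.
-/

set_option maxRecDepth 200000
set_option maxHeartbeats 8000000

namespace Summit.HodgeConjecture.HodgeConjecture.HodgeLocus.Census.DualDegreeFormula

/-- coefficient `k` of the product of two coefficient lists -/
def mulCoeff (a b : List ℕ) (k : ℕ) : ℕ :=
  ((List.range (k + 1)).map fun i => a.getD i 0 * b.getD (k - i) 0).sum

/-- product of two coefficient lists (all coefficients) -/
def polyMul (a b : List ℕ) : List ℕ :=
  (List.range (a.length + b.length - 1)).map (mulCoeff a b)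

/-- coefficient list of `(1 + T + ⋯ + T^{e-1})^c` -/
def ciHilbList (e : ℕ) : ℕ → List ℕ
  | 0 => [1]
  | c + 1 => polyMul (ciHilbList e c) (List.replicate e 1)

/-- `H c e k` = Hilbert function in degree `k` of a complete intersection of `c` forms of degree `e` in `c` variables -/
def H (c e k : ℕ) : ℕ := (ciHilbList e c).getD k 0

/-- the dual-degree deficiency `β` of the cell `(n, d, m) = (2p, d, c - 1)`: `H(t - d) ∸ H(d)`, `t = (p+1)(d-2)` -/
def beta (p d c : ℕ) : ℕ := H c (d - 1) ((p + 1) * (d - 2) - d) - H c (d - 1) d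

/-- the twelve positive cells and their values (everything else `0`), indexed by `(p, d, c)` with `n = 2p`, `m = c - 1` -/
def betaTable (p d c : ℕ) : ℕ :=
  if p = 2 ∧ d = 3 then 1                               -- cubic fourfolds, c = 0, 1, 2 (m = -1, 0, 1)
  else if p = 2 ∧ d = 4 ∧ c = 1 then 1                  -- (4,4,0)
  else if p = 2 ∧ d = 4 ∧ c = 2 then 2                  -- (4,4,1)
  else if p = 2 ∧ d = 5 ∧ c = 2 then 1                  -- (4,5,1)
  else if p = 3 ∧ d = 3 ∧ c = 1 then 1                  -- (6,3,0)
  else if p = 3 ∧ d = 3 ∧ (c = 2 ∨ c = 3) then 2        -- (6,3,1), (6,3,2)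
  else if p = 4 ∧ d = 3 ∧ c = 2 then 1                  -- (8,3,1)
  else if p = 4 ∧ d = 3 ∧ (c = 3 ∨ c = 4) then 2        -- (8,3,2), (8,3,3)
  else 0

/-- sanity: the series `(4,d,1)` (`p = 2`, `c = 2`): `β = 6 ∸ d` for `4 ≤ d ≤ 9` -/
theorem beta_series_4d1 : ∀ d, 4 ≤ d → d ≤ 9 → beta 2 d 2 = 6 - d := by decide

/-- ENUMERATION on the census range: `2 ≤ p ≤ 7`, `3 ≤ d ≤ 9`, `c ≤ p` (and `c ≤ 2` suffices for `p = 2, d = 3`). -/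
theorem beta_eq_table : ∀ p, 2 ≤ p → p ≤ 7 → ∀ d, 3 ≤ d → d ≤ 9 → ∀ c, c ≤ p → beta p d c = betaTable p d c := by
  decide

/-- the degree-`d` value behind the census codimension: `H c (d-1) d = C(c-1+d, d) - c^2` on the same range -/
theorem H_at_d : ∀ c, 1 ≤ c → c ≤ 8 → ∀ d, 3 ≤ d → d ≤ 9 → H c (d - 1) d = Nat.choose (c - 1 + d) d - c ^ 2 := by
  decide

end Summit.HodgeConjecture.HodgeConjecture.HodgeLocus.Census.DualDegreeFormula
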